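import Summits.CriticalPhenomena.PercolationContinuityZ3.Theorems.PercNearOneGluingAdditiveGluingAL5RestrictedLemma5
import HarnessLib

/-! # Crux `PercNearOneGluing.AdditiveGluing` (stmt-CriticalPhenomena-4576) — AL5 for EVERY relay set under the
# restricted anchor condition

Support file (`--supports stmt-CriticalPhenomena-4576`; task png-dp-al5); no definitions, no named facts.  Notation of
`…AL5Layers.lean`: `μ_w = prodBernoulli w`, target `b`, `τ_w(v) = μ_w(v ↔ b)`, bystander `x`, glued block
`w^S := fun e => if e ∈ S.image (s(x,·)) then 1 else w e`, relay neighbours `T` with star `F = T.image (s(x,·))`,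
`R = {ω | ∃ a ∈ T, s(x,a) ∈ ω}`; AL5(T): `μ_{w^S}(R ∩ {d ↔ b}) ≤ μ_{w^S}(R ∩ {x ↔ b})`.

* `al5_restricted_core` — for a pattern `J ⊆ F` containing `s(x,a)`: if in the weighting with ALL relay edges deleted
  (`pinW w F ∅`, block star at its real weights) `μ(d ↮ Z, d ↔ b) ≤ μ(d ↮ Z, a ↔ b)`, `Z = {x} ∪ S`, then
  `τ(d) ≤ τ(x)` under the glued pinned weighting `pinW w^S F J` (restricted Lemma 5 twice — star `J` at `x`, then the block
  star together with `s(x,a)` — and the observation that off `{d ↮ Z}` the events `d ↔ b`, `a ↔ b` agree once `Z ∪ {a}` is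
  glued).
* `al5_of_restrictedAnchor` — **AL5 for every `T` and every block** when `d` is RESTRICTED-minimal among `T ∪ {d}` in the
  relay-deleted weighting: `μ₀(d ↮ Z, d ↔ b) ≤ μ₀(d ↮ Z, a ↔ b)` for all `a ∈ T` (task census: ≈ 95 % of random instances,
  vs. ≈ 84 % for plain deleted-minimality, `al5_of_min_deleted`); then EVERY pattern margin is nonnegative.
* `al5_of_card_le_three_rpeel` — `|T| ≤ 3` and the restricted premise for ONE relay (via `al5_peel`).
[cite: KozmaNitzan2024, Lemma 3(i) (pp. 6–7), Lemma 5 (p. 13)] [cite: VandenbergHaggstromKahn2005, Thms. 1.3–1.5]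
-/

namespace Summit.CriticalPhenomena.PercolationContinuityZ3.Theorems

open MeasureTheory Set
open Literature.Probability.LatticeModels (prodBernoulli)
open Literature.Probability.Percolation (BondConfig openConn openConnIn openGraph openEdgeCluster pinW localCylinder
  DeterminedBy determinedBy_iff)

noncomputable section
open Classical

section AL5RestrictedAnchor

open Filter Topology Literature.Probability.LatticeModels Literature.Probability.Percolation

variable {n : ℕ}

/-- **Per-pattern core of the restricted anchor.**  `F = T.image (s(x,·))`, `J ⊆ F` a pattern containing `s(x,a)`
(`a ∈ T`), `Z = {x} ∪ S`, `M = {d ↮ Z}` (`d ∉ Z`, `d ≠ a`).  If in the relay-deleted weighting `pinW w F ∅` (block star at its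
real weights) `μ(M ∩ {d↔b}) ≤ μ(M ∩ {a↔b})`, then `τ(d) ≤ τ(x)` under the glued pinned weighting `pinW w^S F J`.
Proof: restricted Lemma 5 for the star `J` at `x` (endpoint `a`), then for the star `x–S` together with `s(x,a)`
(endpoint `a`); finally, once `Z ∪ {a}` is glued, `{d ↔ b}` and `{a ↔ b}` coincide off `M` almost surely.
[cite: KozmaNitzan2024, Lemma 5 (p. 13), Lemma 3(i) (pp. 6–7)] -/
theorem al5_restricted_core (w : Sym2 (Fin n) → unitInterval) (S T : Finset (Fin n)) (x d b a : Fin n)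
    (hS : ∀ y ∈ S, y ≠ x) (hxT : x ∉ T) (hST : Disjoint S T) (hdx : d ≠ x) (hdS : d ∉ S) (hda : d ≠ a)
    (haT : a ∈ T) (J : Finset (Sym2 (Fin n))) (hJF : J ⊆ T.image (fun y => s(x, y))) (haJ : s(x, a) ∈ J)
    (hle : (prodBernoulli (pinW w (↑(T.image (fun y => s(x, y))) : Set (Sym2 (Fin n)))
        (↑(∅ : Finset (Sym2 (Fin n))) : Set (Sym2 (Fin n))))).real
        ({ω : BondConfig (Fin n) | ∀ z ∈ (↑(insert x S) : Set (Fin n)), ¬ (openGraph ω).Reachable d z} ∩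
          openConn d b) ≤
      (prodBernoulli (pinW w (↑(T.image (fun y => s(x, y))) : Set (Sym2 (Fin n)))
        (↑(∅ : Finset (Sym2 (Fin n))) : Set (Sym2 (Fin n))))).real
        ({ω : BondConfig (Fin n) | ∀ z ∈ (↑(insert x S) : Set (Fin n)), ¬ (openGraph ω).Reachable d z} ∩
          openConn a b)) :
    (prodBernoulli (pinW (fun e : Sym2 (Fin n) => if e ∈ S.image (fun y => s(x, y)) then 1 else w e)
        (↑(T.image (fun y => s(x, y))) : Set (Sym2 (Fin n))) ↑J)).real (openConn d b) ≤
      (prodBernoulli (pinW (fun e : Sym2 (Fin n) => if e ∈ S.image (fun y => s(x, y)) then 1 else w e)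
        (↑(T.image (fun y => s(x, y))) : Set (Sym2 (Fin n))) ↑J)).real (openConn x b) := by
  set F : Finset (Sym2 (Fin n)) := T.image (fun y => s(x, y)) with hFdef
  set X : Set (Fin n) := (↑(insert x S) : Set (Fin n)) with hXdef
  set M : Set (BondConfig (Fin n)) := {ω | ∀ z ∈ X, ¬ (openGraph ω).Reachable d z} with hM
  have hax : a ≠ x := fun h => hxT (h ▸ haT)
  have hdX : d ∉ X := by
    rw [hXdef, Finset.coe_insert]
    rintro (h | h)
    · exact hdx h
    · exact hdS (Finset.mem_coe.1 h)
  have haF : s(x, a) ∈ F := by rw [hFdef]; exact Finset.mem_image_of_mem _ haT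
  have hF : ∀ e ∈ F, ∃ a', a' ≠ x ∧ e = s(x, a') := by
    intro e he
    obtain ⟨a', ha'T, rfl⟩ := Finset.mem_image.1 he
    exact ⟨a', fun h => hxT (h ▸ ha'T), rfl⟩
  -- step 1: glue the star `J` at `x`
  set w₀ : Sym2 (Fin n) → unitInterval := pinW w ↑F ↑(∅ : Finset (Sym2 (Fin n))) with hw₀
  have h1 := starGlue_lemma5_restricted w₀ x J (fun e he => hF e (hJF he)) d a b X hdX hda haJ hax hle
  rw [← pinW_eq_ite_pinW_empty w hJF] at h1
  -- step 2: glue the block star together with `s(x,a)`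
  set D' : Finset (Sym2 (Fin n)) := insert s(x, a) (S.image (fun y => s(x, y))) with hD'
  have hD'star : ∀ e ∈ D', ∃ a', a' ≠ x ∧ e = s(x, a') := by
    intro e he
    rw [hD', Finset.mem_insert] at he
    rcases he with rfl | he
    · exact ⟨a, hax, rfl⟩
    · obtain ⟨y, hyS, rfl⟩ := Finset.mem_image.1 he
      exact ⟨y, hS y hyS, rfl⟩
  have haD' : s(x, a) ∈ D' := by rw [hD']; exact Finset.mem_insert_self _ _
  have h2 := starGlue_lemma5_restricted (pinW w ↑F ↑J) x D' hD'star d a b X hdX hda haD' hax h1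
  set g₂ : Sym2 (Fin n) → unitInterval := fun e => if e ∈ D' then 1 else pinW w ↑F ↑J e with hg₂
  change (prodBernoulli g₂).real (M ∩ openConn d b) ≤ (prodBernoulli g₂).real (M ∩ openConn a b) at h2
  -- `g₂` is the glued pinned weighting
  have hg₂eq : pinW (fun e : Sym2 (Fin n) => if e ∈ S.image (fun y => s(x, y)) then 1 else w e) ↑F ↑J = g₂ := by
    rw [al5_pinW_glue_comm w S T x hS hST ↑J]
    funext e
    by_cases heS : e ∈ S.image (fun y => s(x, y))
    · have heD : e ∈ D' := by rw [hD']; exact Finset.mem_insert_of_mem heS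
      simp only [heS, if_true, hg₂, heD]
    · by_cases hea : e = s(x, a)
      · subst hea
        simp only [heS, if_false, hg₂, haD', if_true]
        exact pinW_apply_of_mem_of_mem w (Finset.mem_coe.2 haF) (Finset.mem_coe.2 haJ)
      · have heD : e ∉ D' := by
          rw [hD', Finset.mem_insert, not_or]; exact ⟨hea, heS⟩
        simp only [heS, if_false, hg₂, heD, if_false]
        rfl
  rw [hg₂eq]
  -- step 3: off `M`, `{d ↔ b}` and `{a ↔ b}` agree almost surely under `g₂`
  have hae : ∀ᵐ ω ∂prodBernoulli g₂, ∀ e ∈ D', e ∈ ω := by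
    rw [Filter.eventually_all_finset]
    intro e he
    exact prodBernoulli_ae_mem_of_eq_one g₂ (by simp only [hg₂, he, if_true])
  have hMm : MeasurableSet M := MeasurableSet.of_discrete
  have hoff : (prodBernoulli g₂).real ((openConn d b : Set (BondConfig (Fin n))) \ M) =
      (prodBernoulli g₂).real ((openConn a b : Set (BondConfig (Fin n))) \ M) := by
    refine measureReal_congr ?_
    filter_upwards [hae] with ω hω
    have hxa : (openGraph ω).Reachable x a :=
      ((openGraph_adj ω x a).2 ⟨hω _ haD', hax.symm⟩).reachable
    have hdx_of : ¬ ω ∈ M → (openGraph ω).Reachable d a := by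
      intro hnM
      simp only [hM, Set.mem_setOf_eq, not_forall, not_not] at hnM
      obtain ⟨z, hzX, hdz⟩ := hnM
      rw [hXdef, Finset.coe_insert, Set.mem_insert_iff] at hzX
      rcases hzX with rfl | hzS
      · exact hdz.trans hxa
      · have hzS' : z ∈ S := Finset.mem_coe.1 hzS
        have hzx : (openGraph ω).Reachable z x := by
          have he : s(x, z) ∈ D' := by
            rw [hD']; exact Finset.mem_insert_of_mem (Finset.mem_image_of_mem _ hzS')
          rw [Sym2.eq_swap] at he
          exact ((openGraph_adj ω z x).2 ⟨hω _ he, hS z hzS'⟩).reachable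
        exact (hdz.trans hzx).trans hxa
    refine propext ⟨fun ⟨hdb, hnM⟩ => ⟨?_, hnM⟩, fun ⟨hab, hnM⟩ => ⟨?_, hnM⟩⟩
    · exact (hdx_of hnM).symm.trans hdb
    · exact (hdx_of hnM).trans hab
  have hsd := measureReal_inter_add_sdiff (μ := prodBernoulli g₂) (s := (openConn d b : Set (BondConfig (Fin n))))
    hMm
  have hsa := measureReal_inter_add_sdiff (μ := prodBernoulli g₂) (s := (openConn a b : Set (BondConfig (Fin n))))
    hMm
  rw [Set.inter_comm] at hsd hsa
  have hax' : (prodBernoulli g₂).real (openConn a b) = (prodBernoulli g₂).real (openConn x b) :=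
    al5_real_openConn_eq_of_weight_one g₂ b (by simp only [hg₂, haD', if_true]) hax
  rw [← hax']
  linarith

/-- **AL5 for EVERY relay set and EVERY block under the restricted anchor condition.**  `x ∉ S ∪ T`, `S ∩ T = ∅`,
`d ∉ {x} ∪ S ∪ T`; `F = T.image (s(x,·))`, `Z = {x} ∪ S`.  If for every `a ∈ T`, in the relay-deleted weighting
`pinW w F ∅`, `μ(d ↮ Z, d ↔ b) ≤ μ(d ↮ Z, a ↔ b)` (restricted minimality of `d`), then
`μ_{w^S}(R ∩ {d↔b}) ≤ μ_{w^S}(R ∩ {x↔b})` — indeed every pattern margin is nonnegative (`al5_restricted_core`).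
(The plain hypotheses `τ_w(d) ≤ τ_w(a)` are not even needed for this route.)
[cite: KozmaNitzan2024, Lemma 3(i) (pp. 6–7), Lemma 5 (p. 13)] -/
theorem al5_of_restrictedAnchor (w : Sym2 (Fin n) → unitInterval) (S T : Finset (Fin n)) (x d b : Fin n)
    (hS : ∀ y ∈ S, y ≠ x) (hxT : x ∉ T) (hST : Disjoint S T) (hdx : d ≠ x) (hdS : d ∉ S) (hdT : d ∉ T)
    (hra : ∀ a ∈ T, (prodBernoulli (pinW w (↑(T.image (fun y => s(x, y))) : Set (Sym2 (Fin n)))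
        (↑(∅ : Finset (Sym2 (Fin n))) : Set (Sym2 (Fin n))))).real
        ({ω : BondConfig (Fin n) | ∀ z ∈ (↑(insert x S) : Set (Fin n)), ¬ (openGraph ω).Reachable d z} ∩
          openConn d b) ≤
      (prodBernoulli (pinW w (↑(T.image (fun y => s(x, y))) : Set (Sym2 (Fin n)))
        (↑(∅ : Finset (Sym2 (Fin n))) : Set (Sym2 (Fin n))))).real
        ({ω : BondConfig (Fin n) | ∀ z ∈ (↑(insert x S) : Set (Fin n)), ¬ (openGraph ω).Reachable d z} ∩
          openConn a b)) :
    (prodBernoulli (fun e : Sym2 (Fin n) => if e ∈ S.image (fun y => s(x, y)) then 1 else w e)).real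
        ({ω : Set (Sym2 (Fin n)) | ∃ a ∈ T, s(x, a) ∈ ω} ∩ openConn d b) ≤
      (prodBernoulli (fun e : Sym2 (Fin n) => if e ∈ S.image (fun y => s(x, y)) then 1 else w e)).real
        ({ω : Set (Sym2 (Fin n)) | ∃ a ∈ T, s(x, a) ∈ ω} ∩ openConn x b) := by
  set F : Finset (Sym2 (Fin n)) := T.image (fun y => s(x, y)) with hFdef
  set gS : Sym2 (Fin n) → unitInterval := fun e => if e ∈ S.image (fun y => s(x, y)) then 1 else w e with hgS
  have hR : {ω : Set (Sym2 (Fin n)) | ∃ a ∈ T, s(x, a) ∈ ω} = {ω | ∃ e ∈ F, e ∈ ω} := by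
    ext ω
    simp only [Set.mem_setOf_eq, hFdef, Finset.mem_image]
    constructor
    · rintro ⟨a, haT, ha⟩; exact ⟨s(x, a), ⟨a, haT, rfl⟩, ha⟩
    · rintro ⟨e, ⟨a, haT, rfl⟩, he⟩; exact ⟨a, haT, he⟩
  rw [hR]
  set R : Set (Set (Sym2 (Fin n))) := {ω | ∃ e ∈ F, e ∈ ω} with hRdef
  have hdec := fun v : Fin n =>
    prodBernoulli_real_inter_eq_sum_pinW gS F (A := openConn v b) (B := R) MeasurableSet.of_discrete
      (DepthOneGluing.determinedBy_exists_mem F)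
  rw [Set.inter_comm R (openConn d b), Set.inter_comm R (openConn x b), hdec d, hdec x]
  refine Finset.sum_le_sum fun J hJ => mul_le_mul_of_nonneg_left ?_ measureReal_nonneg
  obtain ⟨hJF, hJR⟩ := (@Finset.mem_filter _ _ (_) _ _).1 hJ
  obtain ⟨e, heF, heJ⟩ := hJR
  obtain ⟨a, haT, rfl⟩ := Finset.mem_image.1 heF
  exact al5_restricted_core w S T x d b a hS hxT hST hdx hdS (fun h => hdT (h ▸ haT)) haT J
    (Finset.mem_powerset.1 hJF) (Finset.mem_coe.1 heJ) (hra a haT)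

/-- **AL5 for every block with three relay neighbours under the restricted premise for ONE relay** (`al5_peel` with the
pinned comparison supplied by `al5_restricted_core` for the pattern `{s(x,a)}`): `T.card ≤ 3`, `a ∈ T`,
`τ_w(d) ≤ τ_w(a')` on `T`, and `μ(d ↮ Z, d ↔ b) ≤ μ(d ↮ Z, a ↔ b)` in the relay-deleted weighting.
[cite: KozmaNitzan2024, Lemma 3(i) (pp. 6–7), Lemma 5 (p. 13)] -/
theorem al5_of_card_le_three_rpeel (w : Sym2 (Fin n) → unitInterval) (S T : Finset (Fin n)) (x d b a : Fin n)
    (hS : ∀ y ∈ S, y ≠ x) (hxT : x ∉ T) (hST : Disjoint S T) (hT : T.card ≤ 3) (haT : a ∈ T)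
    (hdx : d ≠ x) (hdS : d ∉ S) (hda : d ≠ a)
    (hle : ∀ a' ∈ T, (prodBernoulli w).real (openConn d b) ≤ (prodBernoulli w).real (openConn a' b))
    (hra : (prodBernoulli (pinW w (↑(T.image (fun y => s(x, y))) : Set (Sym2 (Fin n)))
        (↑(∅ : Finset (Sym2 (Fin n))) : Set (Sym2 (Fin n))))).real
        ({ω : BondConfig (Fin n) | ∀ z ∈ (↑(insert x S) : Set (Fin n)), ¬ (openGraph ω).Reachable d z} ∩
          openConn d b) ≤
      (prodBernoulli (pinW w (↑(T.image (fun y => s(x, y))) : Set (Sym2 (Fin n)))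
        (↑(∅ : Finset (Sym2 (Fin n))) : Set (Sym2 (Fin n))))).real
        ({ω : BondConfig (Fin n) | ∀ z ∈ (↑(insert x S) : Set (Fin n)), ¬ (openGraph ω).Reachable d z} ∩
          openConn a b)) :
    (prodBernoulli (fun e : Sym2 (Fin n) => if e ∈ S.image (fun y => s(x, y)) then 1 else w e)).real
        ({ω : Set (Sym2 (Fin n)) | ∃ a' ∈ T, s(x, a') ∈ ω} ∩ openConn d b) ≤
      (prodBernoulli (fun e : Sym2 (Fin n) => if e ∈ S.image (fun y => s(x, y)) then 1 else w e)).real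
        ({ω : Set (Sym2 (Fin n)) | ∃ a' ∈ T, s(x, a') ∈ ω} ∩ openConn x b) := by
  refine al5_peel w S T x d b a haT hxT ?_ ?_
  · have hcard : (T.erase a).card ≤ 2 := by
      rw [Finset.card_erase_of_mem haT]; omega
    exact al5_of_card_le_two w S (T.erase a) x d b hS (fun h => hxT (Finset.mem_of_mem_erase h))
      (Finset.disjoint_of_subset_right (Finset.erase_subset a T) hST) hcard
      (fun a' ha' => hle a' (Finset.mem_of_mem_erase ha'))
  · have key := al5_restricted_core w S T x d b a hS hxT hST hdx hdS hda haT {s(x, a)}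
      (Finset.singleton_subset_iff.2 (Finset.mem_image_of_mem _ haT)) (Finset.mem_singleton_self _) hra
    rwa [Finset.coe_singleton] at key

end AL5RestrictedAnchor

end

end Summit.CriticalPhenomena.PercolationContinuityZ3.Theorems
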